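import Literature.MathematicalPhysics.QuantumFieldTheory.Balaban1983to89.B9Cor36GpCoverBinders
import Literature.MathematicalPhysics.QuantumFieldTheory.Balaban1983to89.B9Thm311DeltaPrimePos

/-!
# `Balaban1983to89.B9Cor36GpCoverBindersUnitary` — FILE 8's G′-junction AT THE UNITARY MATRIX FIBRE: [B9] Theorem 3.7 ⇒ Theorem 3.1 (3.42)₁₋₄ for def-Y's
# letter of record `G′(U) = GpY i parSymY U` at a `U(N)`-valued (3.35)-regular background, for every member above one threshold, from the per-cube
# (3.35) data — with `G′Δ′_a = 1` (Thm 3.11), the bi-contractivity of bond variables ∕ averaging transporters, the neighbourhoods of index bonds and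
# print's units `η = L^{−k}` ALL DISCHARGED: only the data family and the section `ιB` stay displayed (sub-row G-B9-LETTERS, module M5.1b-G′, FILE 9,
# seat p33; the form the M5.9 assembler instantiates)

T. Bałaban, *Propagators for lattice gauge theories in a background field*, Commun. Math. Phys. **99** (1985) 389–434
[`Balaban1985BackgroundPropagators`, "B9"]; [4] = T. Bałaban, *Propagators and renormalization transformations for lattice gauge
theories. II*, Commun. Math. Phys. **96** (1984) 223–250 [`Balaban1984PropagatorsII`].

statement-level skeleton of published theorems with citation tags; proofs where landed; nothing here is a claim about the
Yang–Mills mass gap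

THE PRINTED LOCUS (verbatim, held `paper:balaban1985-cmp99-background-propagators`, journal page = PDF page + 388).  p. 389 («gauge field configurations U
with values in a compact Lie group G ⊂ U(N)»); (3.24)–(3.25) p. 394 («G′ = (Δ′_a)⁻¹»), Thm 3.11 p. 416 (positivity of `Δ′_a`); Cor. 3.6 p. 408 l. 1–10, l. 20–25;
Thm 3.7 (3.87)–(3.90) pp. 409–410 («follows simply from Corollary 3.6 holding for all G′_□, □ ∈ 𝒟, from the bound (3.89) and Lemma 2.1», «For M sufficiently
large»); Thm 3.1 (3.42) p. 397; [4] (2.1) p. 224 («η = L^{−k}»), Lemma 2.1 (2.61) p. 234.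

WHY THIS FILE.  FILE 8 (`B9Cor36GpCoverBinders.eBlock_Gp_of_cubeData`) is generic in the coefficient algebra `𝔸` and therefore displays, besides the per-cube
(3.35) data, five member-level inputs that are AUTOMATIC at print's fibre `𝔸 = M_N(ℂ)`, `U` with values in `G ≤ U(N)`: (a) `G′(U)Δ′_a(U) = 1` for def-Y's
`G′ = GpY i parSymY` — Thm 3.11 (`B9Thm311DeltaPrimePos.isUnit_deltaPrimeAY_parSymY` + `Node00.GpY_mul_deltaPrimeAY`); (b) bi-contractive bond variables and
(c) bi-contractive averaging transporters — unitaries have norm `1` (`B7Prop2Explicit.unitaryUnits_le_U1`; the transporters of `parSymY` are products of bond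
variables, `Node00.parSymY_mem`); (d) the neighbourhoods `Tn` of index bonds containing the unit balls with a member-independent count — [4] Lemma 2.1 (2.61) at
rate `1` (`B9GeoLemma21KLevelV1.rowSum261_geo9K`: the unit ball has at most `⌈e·c⌉` points, §1); (e) `etaS i = η` — print's units `c_f = L^k` (§2).  §3
`exists_cubeData_of_reg335Cubes` is the datum bookkeeping the assembler needs ONCE for both sides: from the (3.35) class predicate `Reg335Cube` on every cube's
neighbourhood `Q_□` (scale `ξ_□`, constant `C_□`), a FAMILY of bi-contractive gauges `u_□` and potentials `A_□` with the four datum clauses (p33 FILE 4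
`exists_gauge_fld_of_reg335Cube` cube by cube + choice) — the common input of p21's E2-6 `cinvLoc_cover_binders` and of §4.  §4 ★★★ `eBlock_GpY_of_cubeData_unitary`
is FILE 8 with (a)–(e) discharged (gauges bi-contractive as in E2-6; for `G`-valued gauges use `bicontractive_of_mem`).

HONEST SCOPE / NOT CLAIMED.  Composition of landed theorems (FILE 8, Thm 3.11's positivity file, [4] Lemma 2.1's row sum) — no estimate added.  DISPLAYED: the
per-cube (3.35) data family in p33's `gp_cube_at_locCfg` form with bi-contractive gauges (E2-6's binder list verbatim), the member thresholds (existential, incl. the row-sum threshold), the (3.37)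
smallness `α₁(□) ≤ min(a₁, 1∕4)`, `c_f = L^k`, the section `ιB`, a real basis `b` of `M_N(ℂ)` with coordinate bound `M₂`, `N ≥ 1`.  NOT supplied: M5.6's `hD`
(cell GAPS G-B9-05), `IsUnit XY`, `hpar`, the bond-sector letter (M5.1b-G), the assembler's instantiation.  Sup-entries (3.42)₁₋₄ only; finite 𝕋 members;
count-neutral; no summit ∕ sub-problem statement is proved; nothing continuum ∕ OS ∕ mass-gap ∕ Clay; NOT a node discharge.  No `sorry`, no `axiom`, no
`… : Prop` fact, no `instance`, no `notation`, no `def`.  NEW file; nothing landed is modified.  Cell `lit-balaban`, seat `lit-balaban-p33` gen 98, 2026-08-28;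
`--supports stmt-QuantumFields-19200` as helper.  Net new unproved facts: 0.

RELATED IN THE TREE, NOT DUPLICATED (searched 2026-08-28: `lean search 'unitBall_geo9K|etaS_eq_kGeo_eta|GpY_of_cubeData|cubeData_of_reg335' --decl` = ∅; nearest:
`B9Ineq349SiteFromBlocks.etaS_eq_abs_cf_inv` ∕ `B9SectBGpReadingsY.etaS_eq_eta` — the same unit identity on the `MemberY` records, not on a `KIdx` with `hcf`;
restated here in four lines rather than importing those cones): FILE 8 (USED), `B9B8KnitLetterE12FromM55.restrict_GpY_mul_deltaPrimeAY_parSymY` (p33 J-B 15; the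
same Thm-3.11 discharge inside the knit cone).
-/

noncomputable section

open scoped BigOperators Matrix Matrix.Norms.L2Operator

namespace Literature.MathematicalPhysics.QuantumFieldTheory.Balaban1983to89.B9Cor36GpCoverBindersUnitary

open B4PartitionUnity22 (thetaProf D1)
open B9Eq39Adjoint (fluct covD)
open B6KLevelCensusIndexV1 (KIdx kGeo)
open B6Cover236MultiLevelBlocks (cubes)
open B6GlobalChartV1 (PV boxEquiv)
open B6Ineq2142KLevelV1 (β)
open B6Prop22KLevelTorusCensusEta (nKT)
open B9BackgroundsKLevelV1 (shiftsV1)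
open B9Eq360DeltaPrimeAY (AfldY)
open B9CubeGeometryInputs (RM1)
open B9GeoNormsKLevelV1 (geo9K)
open B9GeoLemma21KLevelV1 (rowSum261_geo9K geo9K_dist_comm)
open B9FromB6 (EBlock)
open B9CubeLettersInvReadings (kernelFamilySInv)
open B9Cor36CubeCutoffs (SC NearC chiY locCfgY exists_gauge_fld_of_reg335Cube)
open B9Eq335RegularityClasses (Reg335Cube)
open B9Cor36GpCubeLocLetter (locLetterY)
open B9Cor36GpCoverBinders (eBlock_Gp_of_cubeData)
open B9Thm37GpAtCoverLarge (geo9K_M_eq')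
open B9Thm311DeltaPrimePos (isUnit_deltaPrimeAY_parSymY)
open B7Prop1Explicit (mem_U1)
open B7Prop2Explicit (unitaryUnits unitaryUnits_le_U1)
open Node00 (SiteY BlkY CfgY GaugeY IBondY toKT gaugeY parSymY parSymY_mem deltaPrimeAY GpY GpY_mul_deltaPrimeAY UboxY avgTrY etaS)

variable {d ℓ : ℕ} {hd : 1 ≤ d + 1} {hL : Odd (ℓ + 1) ∧ 1 < ℓ + 1} {b₀ b₁ : ℝ}

/-! ## §1 [4] Lemma 2.1 (2.61) at rate `1` ⇒ neighbourhoods of index bonds containing the unit balls, member-independent count -/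

section Neighbourhoods

variable [∀ i' : KIdx d ℓ hd hL b₀ b₁, Fintype (geo9K i').Site]

/-- ★ **THE UNIT BALLS OF THE MEMBERS' GEOMETRY HAVE A MEMBER-INDEPENDENT CARDINALITY ABOVE ONE THRESHOLD** (M5.5's neighbourhood binders `Tn`, `hTn`, `hnbr`): from [4]
Lemma 2.1 (2.61) at rate `κ = 1` (`Σ_{y′} e^{−d(y,y′)} ≤ c` for `M ≥ M_L`) and the symmetry of `d`, the ball `{a : d(a, y′) ≤ 1}` has at most `⌈e·c⌉` points:
`1 ≤ e·e^{−d(y′,a)}` on it.  [cite: Balaban1984PropagatorsII, Lemma 2.1 (2.61) p.234, (2.54) p.233] -/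
theorem exists_unitBall_geo9K :
    ∃ ML : ℝ, ∃ mN : ℕ, ∀ i : KIdx d ℓ hd hL b₀ b₁, ML ≤ (geo9K i).M →
      ∃ Tn : (geo9K i).Site → Finset (geo9K i).Site,
        (∀ a y' : (geo9K i).Site, (geo9K i).dist a y' ≤ 1 → a ∈ Tn y') ∧ (∀ y' : (geo9K i).Site, (Tn y').card ≤ mN) := by
  classical
  obtain ⟨ML, c, h⟩ := rowSum261_geo9K (d := d) (ℓ := ℓ) (hd := hd) (hL := hL) (b₀ := b₀) (b₁ := b₁) 1 one_pos
  refine ⟨ML, ⌈Real.exp 1 * c⌉₊, fun i hM => ?_⟩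
  refine ⟨fun y' => Finset.univ.filter (fun a : (geo9K i).Site => (geo9K i).dist a y' ≤ 1), fun a y' h1 => ?_, fun y' => ?_⟩
  · exact Finset.mem_filter.2 ⟨Finset.mem_univ _, h1⟩
  · have hrow := h i hM y'
    have hle : (((Finset.univ.filter (fun a : (geo9K i).Site => (geo9K i).dist a y' ≤ 1)).card : ℕ) : ℝ) ≤ Real.exp 1 * c := by
      rw [Finset.card_eq_sum_ones, Nat.cast_sum]
      calc ∑ a ∈ Finset.univ.filter (fun a : (geo9K i).Site => (geo9K i).dist a y' ≤ 1), (((1 : ℕ)) : ℝ)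
          ≤ ∑ a ∈ Finset.univ.filter (fun a : (geo9K i).Site => (geo9K i).dist a y' ≤ 1), Real.exp 1 * Real.exp (-(1 * (geo9K i).dist y' a)) := by
            refine Finset.sum_le_sum fun a ha => ?_
            have ha1 : (geo9K i).dist a y' ≤ 1 := (Finset.mem_filter.1 ha).2
            rw [Nat.cast_one, ← Real.exp_add]
            exact Real.one_le_exp (by linarith [(geo9K_dist_comm i y' a).le.trans ha1])
        _ ≤ ∑ a, Real.exp 1 * Real.exp (-(1 * (geo9K i).dist y' a)) :=
            Finset.sum_le_univ_sum_of_nonneg fun a => by positivity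
        _ ≤ Real.exp 1 * c := by rw [← Finset.mul_sum]; exact mul_le_mul_of_nonneg_left hrow (Real.exp_nonneg _)
    have hfin : ((Finset.univ.filter (fun a : (geo9K i).Site => (geo9K i).dist a y' ≤ 1)).card : ℕ) ≤ ⌈Real.exp 1 * c⌉₊ := by
      exact_mod_cast hle.trans (Nat.le_ceil _)
    exact hfin

end Neighbourhoods

/-! ## §2 Print's units: `c_f = L^k` ⇒ `etaS i = η` -/

/-- in print's units `c_f = L^k` the site sector's `η = L^{−k}` IS the geometry's `|c_f|⁻¹` (FILE 8's binder `etaS i = (kGeo i).eta`).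
[cite: Balaban1984PropagatorsII, (2.1) p.224 («η = L^{−k}»)] -/
theorem etaS_eq_kGeo_eta_of_cf (i : KIdx d ℓ hd hL b₀ b₁) (hcf : i.cf = (((ℓ + 1 : ℕ) : ℝ)) ^ i.k) : etaS i = (kGeo i).eta := by
  show etaS i = |i.cf|⁻¹
  unfold etaS nKT
  rw [hcf, abs_of_nonneg (by positivity)]
  push_cast
  rfl

/-! ## §3 The (3.35) class on every cube ⇒ one family of per-cube data (the common input of E2-6 and §4) -/

section Datum

variable {𝔸 : Type} [NormedRing 𝔸] [NormedAlgebra ℂ 𝔸] [CompleteSpace 𝔸] [NormOneClass 𝔸]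

/-- ★ **ONE FAMILY OF PER-CUBE (3.35) DATA FROM THE CLASS PREDICATE ON EVERY CUBE** (FILE 4's `exists_gauge_fld_of_reg335Cube` cube by cube, then choice): if `U` is
(3.35)-regular on every cube's neighbourhood `Q_□` at scale `ξ_□` with constant `C_□` (`Reg335Cube`), there are bi-contractive gauges `u_□` on the torus and
potentials `A_□` with `U^{u_□} = e^{iηA_□}` on the bonds of `Q_□`, `‖A_□‖ ≦ C_□ξ_□⁻¹` and `‖η⁻¹∂A_□‖ ≦ C_□ξ_□⁻²` on `Q_□` — the binders `hu hgA hA hdA` of p21's E2-6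
`cinvLoc_cover_binders`, of FILE 8 and of §4, as FUNCTIONS on the cubes (print: «for each cube □ from 𝒟_j … there exists a gauge transformation u defined on □̃⁵»).
[cite: Balaban1985BackgroundPropagators, (3.35) p.396, Cor. 3.6 p.408 l.1–10 + l.20–25] -/
theorem exists_cubeData_of_reg335Cubes (i : KIdx d ℓ hd hL b₀ b₁) (U : CfgY 𝔸 i)
    (Q : ↥(cubes (toKT i).D.toDomains) → Set (Site (PV d ℓ i.m i.K hd hL) 0)) (ξ C : ↥(cubes (toKT i).D.toDomains) → ℝ)
    (h : ∀ c, Reg335Cube (shiftsV1 (PV d ℓ i.m i.K hd hL)) U (kGeo i).eta (Q c) (ξ c) (C c)) :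
    ∃ (g : ↥(cubes (toKT i).D.toDomains) → GaugeY 𝔸 i) (A : ↥(cubes (toKT i).D.toDomains) → AfldY 𝔸 i),
      (∀ c x, ‖(g c x : 𝔸)‖ ≤ 1 ∧ ‖(((g c x)⁻¹ : 𝔸ˣ) : 𝔸)‖ ≤ 1) ∧
      (∀ c, ∀ (κ : Fin (d + 1)) (x : Site (PV d ℓ i.m i.K hd hL) 0), x ∈ Q c → x.shift κ ∈ Q c → gaugeY i (g c) U κ x = fluct (kGeo i).eta (A c) κ x) ∧
      (∀ c, ∀ κ, ∀ x ∈ Q c, ‖A c κ x‖ ≤ C c * (ξ c)⁻¹) ∧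
      (∀ c, ∀ μ ν, ∀ x ∈ Q c, ‖(((kGeo i).eta : ℂ)⁻¹) • covD (shiftsV1 (PV d ℓ i.m i.K hd hL)) (fun _ _ => (1 : 𝔸ˣ)) μ (A c ν) x‖ ≤ C c * (ξ c ^ 2)⁻¹) := by
  have key := fun c : ↥(cubes (toKT i).D.toDomains) => exists_gauge_fld_of_reg335Cube i norm_one.le (h c)
  choose g A hu hgA hA hdA using key
  exact ⟨g, A, hu, hgA, hA, hdA⟩

end Datum

/-! ## §4 ★★★ FILE 8 at the unitary matrix fibre: Theorem 3.1 (3.42)₁₋₄ for `G′(U) = GpY i parSymY U` from the cube data, data family only -/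

section Unitary

variable {N : ℕ} {G : Subgroup (Matrix (Fin N) (Fin N) ℂ)ˣ}
variable {ι : Type} [Fintype ι] [DecidableEq ι] (b : Module.Basis ι ℝ (Matrix (Fin N) (Fin N) ℂ))

/-- a unit of `G ≤ U(N)` is bi-contractive for the operator norm (`N ≥ 1`). [cite: Balaban1985BackgroundPropagators, p.389 («G ⊂ U(N)»); Balaban1985Averaging, (19) p.21] -/
theorem bicontractive_of_mem [Nonempty (Fin N)] (hG : G ≤ unitaryUnits (Matrix (Fin N) (Fin N) ℂ)) {u : (Matrix (Fin N) (Fin N) ℂ)ˣ} (hu : u ∈ G) :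
    ‖(u : Matrix (Fin N) (Fin N) ℂ)‖ ≤ 1 ∧ ‖((u⁻¹ : (Matrix (Fin N) (Fin N) ℂ)ˣ) : Matrix (Fin N) (Fin N) ℂ)‖ ≤ 1 := by
  letI : CStarAlgebra (Matrix (Fin N) (Fin N) ℂ) := {}
  exact mem_U1.1 (unitaryUnits_le_U1 (hG hu))

/-- bond variables of a `G`-valued configuration are bi-contractive for `G ≤ U(N)`. [cite: Balaban1985BackgroundPropagators, p.389 («G ⊂ U(N)»), (3.3) p.390] -/
theorem uboxY_bicontractive [Nonempty (Fin N)] (hG : G ≤ unitaryUnits (Matrix (Fin N) (Fin N) ℂ)) (i : KIdx d ℓ hd hL b₀ b₁)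
    {U : CfgY (Matrix (Fin N) (Fin N) ℂ) i} (hU : ∀ μ x, U μ x ∈ G) (μ : Fin (d + 1)) (x : SiteY i) :
    ‖(UboxY i U μ x : Matrix (Fin N) (Fin N) ℂ)‖ ≤ 1 ∧ ‖(((UboxY i U μ x)⁻¹ : (Matrix (Fin N) (Fin N) ℂ)ˣ) : Matrix (Fin N) (Fin N) ℂ)‖ ≤ 1 :=
  bicontractive_of_mem hG (hU μ _)

/-- the averaging transporters of def-Y's `parSymY` at a `G`-valued configuration are bi-contractive for `G ≤ U(N)` (products of bond variables).
[cite: Balaban1985BackgroundPropagators, (3.19) p.393, (3.24) p.394, p.389] -/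
theorem avgTrY_parSymY_bicontractive [Nonempty (Fin N)] (hG : G ≤ unitaryUnits (Matrix (Fin N) (Fin N) ℂ)) (i : KIdx d ℓ hd hL b₀ b₁)
    {U : CfgY (Matrix (Fin N) (Fin N) ℂ) i} (hU : ∀ μ x, U μ x ∈ G) (z w : SiteY i) :
    ‖(avgTrY i (parSymY i) U z w : Matrix (Fin N) (Fin N) ℂ)‖ ≤ 1 ∧
      ‖(((avgTrY i (parSymY i) U z w)⁻¹ : (Matrix (Fin N) (Fin N) ℂ)ˣ) : Matrix (Fin N) (Fin N) ℂ)‖ ≤ 1 :=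
  bicontractive_of_mem hG (G.mul_mem (parSymY_mem i hU _ _) (parSymY_mem i hU _ _))

/-- Thm 3.11 at the letter of record: `G′(U)·Δ′_a(U) = 1` for `G′ = GpY i parSymY`, `U` `G`-valued, `G ≤ U(N)`.
[cite: Balaban1985BackgroundPropagators, (3.24)–(3.25) p.394, Thm 3.11 p.416] -/
theorem GpY_parSymY_mul_deltaPrimeAY (hG : G ≤ unitaryUnits (Matrix (Fin N) (Fin N) ℂ)) (i : KIdx d ℓ hd hL b₀ b₁) {U : CfgY (Matrix (Fin N) (Fin N) ℂ) i}
    (hU : ∀ μ x, U μ x ∈ G) : GpY i (parSymY i) U * deltaPrimeAY i (parSymY i) U = 1 :=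
  GpY_mul_deltaPrimeAY i (parSymY i) U (isUnit_deltaPrimeAY_parSymY i hG hU)

/-- ★★★ **THEOREM 3.7 ⇒ THEOREM 3.1 (3.42)₁₋₄ FOR `G′(U) = GpY i parSymY U` AT A `U(N)`-VALUED (3.35)-REGULAR BACKGROUND, FOR EVERY MEMBER ABOVE ONE THRESHOLD, FROM
COROLLARY 3.6's CUBE DATA — DATA FAMILY ONLY** (FILE 8 `eBlock_Gp_of_cubeData` with `G′Δ′_a = 1`, the bi-contractivity of bond variables ∕ transporters, the
neighbourhoods and `η = L^{−k}` discharged by §1–§2 and Thm 3.11): for `G ≤ U(N)`, `N ≥ 1`, the walk data `(Rr, Hp)` and a real basis `b` of `M_N(ℂ)` with coordinate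
bound `M₂` there are `δ_G > 0`, `K_G ≥ 0`, thresholds `M₀, T₀, N₀` and `a₁ > 0` such that for every member above the thresholds with `c_f = L^k`, every section `ιB`,
every `G`-valued `U` and every family of per-cube (3.35) data — bi-contractive gauges `u_□` (§3; `bicontractive_of_mem` for `G`-valued ones), potentials `A_□` on torus sets `Q_□ ⊇ NearC_□(35S_j∕8 + 1)` with
`U^{u_□} = e^{iηA_□}` on their bonds, `‖A_□‖ ≦ C_□ξ_□⁻¹`, `‖η⁻¹∂A_□‖ ≦ C_□ξ_□⁻²`, `0 < ξ_□ ≦ 5S_jη`, `L^{j+1}η ≦ Λ_□ξ_□`, `1 ≦ Λ_□`, `max C_□ (C_□(1+D₁θ))Λ_□² ≦ min(a₁, 1∕4)`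
— and every background family through `U`: `EBlock (kernelFamilySInv i B cfg (GpY i parSymY) parSymY) K_G δ_G U₁` AND, for every cube,
`EBlock (kernelFamilySInv i B cfg (fun _ => locLetterY i □ parSymY (u □) χ_□ (locCfgY i □ η (A □))) parSymY) K_G δ_G U₁` — M5.6's `hE` ∕ `hEc` pair.
[cite: Balaban1985BackgroundPropagators, Thm 3.7 (3.87)–(3.90) pp.409–410, Thm 3.1 (3.42) p.397, Cor. 3.6 p.408, Thm 3.11 p.416, (3.24)–(3.25) p.394; Balaban1984PropagatorsII, Lemma 2.1 (2.61) p.234, (2.1) p.224] -/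
theorem eBlock_GpY_of_cubeData_unitary [Nonempty (Fin N)] [∀ i' : KIdx d ℓ hd hL b₀ b₁, Fintype (geo9K i').Site]
    [∀ i' : KIdx d ℓ hd hL b₀ b₁, DecidableEq (geo9K i').Site] (hG : G ≤ unitaryUnits (Matrix (Fin N) (Fin N) ℂ))
    (Rr : KIdx d ℓ hd hL b₀ b₁ → ℝ) (Hp : KIdx d ℓ hd hL b₀ b₁ → Prop)
    (hℓ : 1 ≤ ℓ) {M₂ : ℝ} (hM₂ : 0 ≤ M₂) (hrepr : ∀ (v : Matrix (Fin N) (Fin N) ℂ) (j : ι), |b.repr v j| ≤ M₂ * ‖v‖) :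
    ∃ δG KG M₀ T₀ : ℝ, ∃ N₀ : ℕ, 0 < δG ∧ 0 ≤ KG ∧ ∃ a₁ : ℝ, 0 < a₁ ∧
    ∀ (i : KIdx d ℓ hd hL b₀ b₁),
      M₀ ≤ ((ℓ : ℝ) + 1) * (toKT i).Mh → N₀ + 1 ≤ (toKT i).R * ((ℓ + 1) * (toKT i).Mh) → T₀ ≤ RM1 i → i.cf = (((ℓ + 1 : ℕ) : ℝ)) ^ i.k →
    ∀ (ιB : BlkY i → IBondY i), (∀ s, β i.hN i.D i.hk (ιB s) = s) →
    ∀ (U : CfgY (Matrix (Fin N) (Fin N) ℂ) i), (∀ μ x, U μ x ∈ G) →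
    ∀ (g : ↥(cubes (toKT i).D.toDomains) → GaugeY (Matrix (Fin N) (Fin N) ℂ) i),
      (∀ c x, ‖(g c x : Matrix (Fin N) (Fin N) ℂ)‖ ≤ 1 ∧ ‖(((g c x)⁻¹ : (Matrix (Fin N) (Fin N) ℂ)ˣ) : Matrix (Fin N) (Fin N) ℂ)‖ ≤ 1) →
    ∀ (A : ↥(cubes (toKT i).D.toDomains) → AfldY (Matrix (Fin N) (Fin N) ℂ) i)
      (Q : ↥(cubes (toKT i).D.toDomains) → Set (Site (PV d ℓ i.m i.K hd hL) 0)) (C ξ Λ : ↥(cubes (toKT i).D.toDomains) → ℝ),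
      (∀ c, 0 ≤ C c) → (∀ c, 0 < ξ c) → (∀ c, 1 ≤ Λ c) → (∀ c, ξ c ≤ 5 * (SC i c : ℝ) * (kGeo i).eta) →
      (∀ c, LatticeNorms.scaleLen ((ℓ : ℝ) + 1) (kGeo i).eta (c.1.1 + 1) ≤ Λ c * ξ c) →
      (∀ c, ∀ x : Site (PV d ℓ i.m i.K hd hL) 0, NearC i c (35 * SC i c / 8 + 1) (boxEquiv i.hN x).1 → x ∈ Q c) →
      (∀ c, ∀ (κ : Fin (d + 1)) (x : Site (PV d ℓ i.m i.K hd hL) 0), x ∈ Q c → x.shift κ ∈ Q c →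
        gaugeY i (g c) U κ x = fluct (kGeo i).eta (A c) κ x) →
      (∀ c, ∀ κ, ∀ x ∈ Q c, ‖A c κ x‖ ≤ C c * (ξ c)⁻¹) →
      (∀ c, ∀ μ ν, ∀ x ∈ Q c,
        ‖(((kGeo i).eta : ℂ)⁻¹) • covD (shiftsV1 (PV d ℓ i.m i.K hd hL)) (fun _ _ => (1 : (Matrix (Fin N) (Fin N) ℂ)ˣ)) μ (A c ν) x‖ ≤ C c * (ξ c ^ 2)⁻¹) →
      (∀ c, max (C c) (C c * (1 + D1 thetaProf)) * Λ c ^ 2 ≤ a₁) → (∀ c, max (C c) (C c * (1 + D1 thetaProf)) * Λ c ^ 2 ≤ 1 / 4) →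
    ∀ {B : B9.Backgrounds} (cfg : B.Cfg → CfgY (Matrix (Fin N) (Fin N) ℂ) i) (U₁ : B.Cfg), cfg U₁ = U →
      EBlock (kernelFamilySInv i B cfg (GpY i (parSymY i)) (parSymY i)) KG δG U₁ ∧
      ∀ c : ↥(cubes (toKT i).D.toDomains),
        EBlock (kernelFamilySInv i B cfg (fun _ => locLetterY i c (parSymY i) (g c) (chiY i c) (locCfgY i c (kGeo i).eta (A c))) (parSymY i)) KG δG U₁ := by
  -- §1: neighbourhoods with a member-independent count above `MLn`
  obtain ⟨MLn, mN, Hn⟩ := exists_unitBall_geo9K (d := d) (ℓ := ℓ) (hd := hd) (hL := hL) (b₀ := b₀) (b₁ := b₁)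
  -- FILE 8 at this count
  obtain ⟨δG, KG, M₀, T₀, N₀, hδG, hKG, a₁, ha₁, H⟩ := eBlock_Gp_of_cubeData (𝔸 := Matrix (Fin N) (Fin N) ℂ) b Rr Hp hℓ hM₂ hrepr mN
  refine ⟨δG, KG, max M₀ MLn, T₀, N₀, hδG, hKG, a₁, ha₁, ?_⟩
  intro i hM hN hT hcf ιB hι U hU g hg A Q C ξ Λ hC0 hξ hΛ hξS hΛξ hQ hgA hA hdA hα₁ hα4 B cfg U₁ hcfg
  have hM₀ : M₀ ≤ ((ℓ : ℝ) + 1) * (toKT i).Mh := (le_max_left _ _).trans hM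
  have hMLn : MLn ≤ (geo9K i).M := by
    rw [geo9K_M_eq' i]; exact (le_max_right _ _).trans hM
  obtain ⟨Tn, hTn, hnbr⟩ := Hn i hMLn
  exact H i hM₀ hN hT ιB hι U g hg A Q C ξ Λ hC0 hξ hΛ hξS hΛξ hQ hgA hA hdA hα₁ hα4
    cfg U₁ hcfg (etaS_eq_kGeo_eta_of_cf i hcf) (GpY i (parSymY i)) (GpY_parSymY_mul_deltaPrimeAY hG i hU)
    (uboxY_bicontractive hG i hU) (avgTrY_parSymY_bicontractive hG i hU) Tn hTn hnbr

end Unitary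

end Literature.MathematicalPhysics.QuantumFieldTheory.Balaban1983to89.B9Cor36GpCoverBindersUnitary

end
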